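import Summits.SmoothPoincare4.SmoothPoincare4.Theorems.EntropyRungConicalGapRicciNormSqIntegrable
import Summits.SmoothPoincare4.SmoothPoincare4.Theorems.EntropyRungConicalGapGradScalarIdentity
import Summits.SmoothPoincare4.SmoothPoincare4.Theorems.EntropyRungConicalGapTracelessRicci
import HarnessLib

/-!
# The weighted curvature hierarchy of line `Sketch`, UNCONDITIONAL (crux `EntropyRung.ConicalGap`,
# stmt-SmoothPoincare4-16589; lead seat c4, cycle 4)

The Munteanu–Sesum bound `∫ |Ric|² e^{-f/σ} dV < ∞` for every `σ > 0`
(`helper_ricciNormSq_integrable`, `EntropyRungConicalGapRicciNormSqIntegrable.lean`) discharges the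
integrability hypothesis `hRic` of two wave-2 results of this cycle, on every complete connected
normalised 4-d gradient shrinking Ricci soliton `(M, g, f)` (`Ric + Hess f = g/2`, `R + |∇f|² = f`),
writing `v = e^{-f/τ}`, `E = Ric − (R/4) g`, `X = g⁻¹(dR, df) = 2 Ric(∇f, ∇f)`:

* `helper_tracelessRicciMoment` — for every `τ > 0`: `|E|² v ∈ L¹` and the TRACELESS Ricci moment
  identity `2 ∫ |E|² v + ½ ∫ R² v = ∫ R v + (τ − 1) [τ⁻² ∫ (f R − R²) v − τ⁻¹ ∫ (2R − R²) v]`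
  (`helper_ricciNormSq_traceless`, p134836, + `ricciMoment_riemVolume`); at `τ = 1`:
  `2 ∫ |E|² e^{-f} = ∫ R e^{-f} − ½ ∫ R² e^{-f}` — so `∫ R² e^{-f} ≤ 2 ∫ R e^{-f}` with equality iff
  the shrinker is Einstein on `supp`, i.e. the deficit in the classical bound is exactly the traceless
  Ricci energy;
* `helper_gradScalar_weightedIdentity_unconditional` — for every `τ > 0`: `|∇R|² v ∈ L¹` and the
  weighted Bochner identity `∫ |∇R|² v = 2 ∫ R |Ric|² v − ∫ R² v − (1 − τ⁻¹) ∫ R X v`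
  (`helper_gradScalar_weightedIdentity`, p134908); at `τ = 1`:
  `∫ |∇R|² e^{-f} = 2 ∫ R |Ric|² e^{-f} − ∫ R² e^{-f}`, whence `∫ R² e^{-f} ≤ 2 ∫ R |Ric|² e^{-f}`.

Everything here is proved; no definition and no named fact is introduced.

## References

* O. Munteanu, N. Sesum, J. Geom. Anal. 23 (2013) 539–561, Thm. 1.4 / 1.5. [MunteanuSesum2013]
* P. Petersen, W. Wylie, *On the classification of gradient Ricci solitons*, Geom. Topol. 14 (2010),
  §2 (weighted Bochner identities for `R` on gradient solitons). [PetersenWylie2010]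
* H.-D. Cao, D. Zhou, J. Differential Geom. 85 (2010) 175–186 (volume growth). [CaoZhou2010]
-/

noncomputable section

-- `Summit.SmoothPoincare4.SmoothPoincare4.…` (summit = problem) trips `dupNamespace` on every decl.
set_option linter.dupNamespace false

open scoped Manifold ContDiff ENNReal NNReal Topology
open MeasureTheory Set Filter Module
open Literature.Geometry.Lorentzian Literature.Geometry.Riemannian

namespace Summit.SmoothPoincare4.SmoothPoincare4.Theorems.ConicalGapSketch

section RiemVolume

variable {M : Type} [TopologicalSpace M] [T2Space M] [SecondCountableTopology M]
  [ChartedSpace (EuclideanSpace ℝ (Fin 4)) M] [IsManifold (𝓡 4) ∞ M] [ConnectedSpace M]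
  [T3Space M] [MeasurableSpace M] [BorelSpace M]

/-- **The traceless Ricci moment identity** (over `g.riemVolume`, UNCONDITIONAL): on a complete
connected normalised 4-d gradient shrinker, for every `τ > 0`, `|E|² e^{-f/τ}` is integrable and
`2 ∫ |E|² e^{-f/τ} + ½ ∫ R² e^{-f/τ} = ∫ R e^{-f/τ} + (τ − 1) [τ⁻² ∫ (f R − R²) e^{-f/τ} − τ⁻¹ ∫ (2R − R²) e^{-f/τ}]`:
`∫ |Ric|² v = ∫ |E|² v + ¼ ∫ R² v` (`integrable_normSq_tracelessRicci_and_integral_eq`) inserted in the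
Ricci moment identity (`ricciMoment_riemVolume`, provisos by `ricciNormSq_integrable`,
`ricciNormSq_innerDual_integrable`). -/
theorem tracelessRicciMoment_riemVolume
    (g : PseudoRiemannianMetric (𝓡 4) ∞ (EuclideanSpace ℝ (Fin 4)) (TangentSpace (𝓡 4) : M → Type _))
    [g.HasLeviCivita] (f : M → ℝ) (hg : g.IsRiemannian)
    (hc : ∀ (x : M) (r : NNReal), IsCompact {y : M | g.edist hg x y ≤ r})
    (hf : ContMDiff (𝓡 4) 𝓘(ℝ, ℝ) ∞ f)
    (hsol : ∀ (x : M) (X Y : TangentSpace (𝓡 4) x),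
      g.ricci x X Y + g.hessian f x X Y = (1 / 2 : ℝ) * g.val x X Y)
    (hnorm : ∀ x : M, g.scalarCurvature x + g.gradSq f x = f x) {τ : ℝ} (hτ : 0 < τ) :
    Integrable (fun x ↦ g.normSq x (g.tracelessRicci x) * Real.exp (-f x / τ)) g.riemVolume ∧
      2 * (∫ x, g.normSq x (g.tracelessRicci x) * Real.exp (-f x / τ) ∂g.riemVolume) +
          1 / 2 * (∫ x, g.scalarCurvature x ^ 2 * Real.exp (-f x / τ) ∂g.riemVolume) =
        (∫ x, g.scalarCurvature x * Real.exp (-f x / τ) ∂g.riemVolume) +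
          (τ - 1) * ((τ ^ 2)⁻¹ *
            ((∫ x, f x * g.scalarCurvature x * Real.exp (-f x / τ) ∂g.riemVolume) -
              (∫ x, g.scalarCurvature x ^ 2 * Real.exp (-f x / τ) ∂g.riemVolume)) -
            τ⁻¹ * (2 * (∫ x, g.scalarCurvature x * Real.exp (-f x / τ) ∂g.riemVolume) -
              (∫ x, g.scalarCurvature x ^ 2 * Real.exp (-f x / τ) ∂g.riemVolume))) := by
  obtain ⟨hR0, -, hprop⟩ :=
    NoncompactShrinkerGapCarrilloNiClauses.scalarCurvature_nonneg_and_isCompact_sublevel g f hg hc hf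
      hsol hnorm
  have iN := ricciNormSq_integrable hg hf hsol hnorm hprop hR0 hτ
  obtain ⟨iE, hsplit⟩ :=
    integrable_normSq_tracelessRicci_and_integral_eq hg hf hsol hnorm hprop hR0 hτ iN
  have hRic := ricciMoment_riemVolume g f hg hc hf hsol hnorm hτ iN
    (ricciNormSq_innerDual_integrable hg hf hsol hnorm hprop hR0 hτ)
  refine ⟨iE, ?_⟩
  rw [hsplit] at hRic
  simp only [Nat.cast_ofNat] at hRic
  linear_combination hRic

/-- **The weighted Bochner identity for `R`, unconditional** (over `g.riemVolume`): on a complete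
connected normalised 4-d gradient shrinker, for every `τ > 0`, `|∇R|² e^{-f/τ}` is integrable and
`∫ |∇R|² e^{-f/τ} = 2 ∫ R |Ric|² e^{-f/τ} − ∫ R² e^{-f/τ} − (1 − τ⁻¹) ∫ R g⁻¹(dR, df) e^{-f/τ}`
(`gradScalar_weightedIdentity_riemVolume` with `hRic` supplied by `ricciNormSq_integrable`). -/
theorem gradScalar_weightedIdentity_riemVolume_unconditional
    (g : PseudoRiemannianMetric (𝓡 4) ∞ (EuclideanSpace ℝ (Fin 4)) (TangentSpace (𝓡 4) : M → Type _))
    [g.HasLeviCivita] (f : M → ℝ) (hg : g.IsRiemannian)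
    (hc : ∀ (x : M) (r : NNReal), IsCompact {y : M | g.edist hg x y ≤ r})
    (hf : ContMDiff (𝓡 4) 𝓘(ℝ, ℝ) ∞ f)
    (hsol : ∀ (x : M) (X Y : TangentSpace (𝓡 4) x),
      g.ricci x X Y + g.hessian f x X Y = (1 / 2 : ℝ) * g.val x X Y)
    (hnorm : ∀ x : M, g.scalarCurvature x + g.gradSq f x = f x) {τ : ℝ} (hτ : 0 < τ) :
    Integrable (fun x ↦ g.gradSq g.scalarCurvature x * Real.exp (-f x / τ)) g.riemVolume ∧
      ∫ x, g.gradSq g.scalarCurvature x * Real.exp (-f x / τ) ∂g.riemVolume =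
        2 * (∫ x, g.scalarCurvature x * g.normSq x (g.ricci x) * Real.exp (-f x / τ)
            ∂g.riemVolume) -
          (∫ x, g.scalarCurvature x ^ 2 * Real.exp (-f x / τ) ∂g.riemVolume) -
          (1 - τ⁻¹) * ∫ x, g.scalarCurvature x *
            g.innerDual x (mvfderiv (𝓡 4) g.scalarCurvature x).toLinearMap
              (mvfderiv (𝓡 4) f x).toLinearMap * Real.exp (-f x / τ) ∂g.riemVolume := by
  obtain ⟨hR0, -, hprop⟩ :=
    NoncompactShrinkerGapCarrilloNiClauses.scalarCurvature_nonneg_and_isCompact_sublevel g f hg hc hf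
      hsol hnorm
  exact gradScalar_weightedIdentity_riemVolume hg hf hsol hnorm hprop hR0
    (fun σ hσ ↦ ricciNormSq_integrable hg hf hsol hnorm hprop hR0 hσ) hτ

end RiemVolume

/-! ## Registered helpers (crux vocabulary) -/

/-- **Helper `helper_tracelessRicciMoment` of line `Sketch`** (the TRACELESS Ricci moment identity
at every scale and at `τ = 1`, `n = 4`, UNCONDITIONAL): on every complete connected normalised 4-d
gradient shrinking Ricci soliton, (i) for every `τ > 0`, `|E|² e^{-f/τ}` (`E = Ric − (R/4) g`) is
`dV`-integrable and
`2 ∫ |E|² e^{-f/τ} dV + ½ ∫ R² e^{-f/τ} dV = ∫ R e^{-f/τ} dV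
  + (τ − 1) [τ⁻² (∫ f R e^{-f/τ} dV − ∫ R² e^{-f/τ} dV) − τ⁻¹ (2 ∫ R e^{-f/τ} dV − ∫ R² e^{-f/τ} dV)]`;
(ii) at `τ = 1`: `2 ∫ |E|² e^{-f} dV = ∫ R e^{-f} dV − ½ ∫ R² e^{-f} dV`
(`dV` the Riemannian measure of `g.toContMDiffRiemannianMetric hg`): `tracelessRicciMoment_riemVolume`. -/
theorem helper_tracelessRicciMoment : ∀ (M : Type) [TopologicalSpace M] [T2Space M] [SecondCountableTopology M] [ChartedSpace (EuclideanSpace ℝ (Fin 4)) M] [IsManifold (𝓡 4) ∞ M] [ConnectedSpace M] [T3Space M] [MeasurableSpace M] [BorelSpace M] (g : Literature.Geometry.Lorentzian.PseudoRiemannianMetric (𝓡 4) ∞ (EuclideanSpace ℝ (Fin 4)) (TangentSpace (𝓡 4) : M → Type _)) [g.HasLeviCivita] (f : M → ℝ) (hg : g.IsRiemannian), (∀ (x : M) (r : NNReal), IsCompact {y : M | g.edist hg x y ≤ r}) → ContMDiff (𝓡 4) 𝓘(ℝ, ℝ) ∞ f → (∀ (x : M) (X Y : TangentSpace (𝓡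 4) x), g.ricci x X Y + g.hessian f x X Y = (1 / 2 : ℝ) * g.val x X Y) → (∀ x : M, g.scalarCurvature x + g.gradSq f x = f x) → (∀ τ : ℝ, 0 < τ → MeasureTheory.Integrable (fun x ↦ g.normSq x (g.tracelessRicci x) * Real.exp (-f x / τ)) (Literature.Geometry.Lorentzian.riemannianMeasure (g.toContMDiffRiemannianMetric hg)) ∧ 2 * (∫ x, g.normSq x (g.tracelessRicci x) * Real.exp (-f x / τ) ∂(Literature.Geometry.Lorentzian.riemannianMeasure (g.toContMDiffRiemannianMetric hg))) + 1 / 2 * (∫ x, g.scalarCurvature x ^ 2 * Real.exp (-f x / τ) ∂(Literature.Geometry.Lorentzian.riemannianMeasure (g.toContMDiffRiemannianMetric hg))) = (∫ x, g.scalarCurvature x * Real.exp (-f x / τ) ∂(Literature.Geometry.Lorentzian.riemannianMeasure (g.toContMDiffRiemannianMetric hg))) + (τ - 1) * ((τ ^ 2)⁻¹ * ((∫ x, f x * g.scalarCurvature x * Real.exp (-f x / τ) ∂(Literature.Geometry.Lorentzian.riemannianMeasure (g.toContMDiffRiemannianMetric hg))) - (∫ x, g.scalarCurvature x ^ 2 *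 Real.exp (-f x / τ) ∂(Literature.Geometry.Lorentzian.riemannianMeasure (g.toContMDiffRiemannianMetric hg)))) - τ⁻¹ * (2 * (∫ x, g.scalarCurvature x * Real.exp (-f x / τ) ∂(Literature.Geometry.Lorentzian.riemannianMeasure (g.toContMDiffRiemannianMetric hg))) - (∫ x, g.scalarCurvature x ^ 2 * Real.exp (-f x / τ) ∂(Literature.Geometry.Lorentzian.riemannianMeasure (g.toContMDiffRiemannianMetric hg)))))) ∧ 2 * (∫ x, g.normSq x (g.tracelessRicci x) * Real.exp (-f x) ∂(Literature.Geometry.Lorentzian.riemannianMeasure (g.toContMDiffRiemannianMetric hg))) = (∫ x, g.scalarCurvature x * Real.exp (-f x) ∂(Literature.Geometry.Lorentzian.riemannianMeasure (g.toContMDiffRiemannianMetric hg))) - 1 / 2 * (∫ x, g.scalarCurvature x ^ 2 * Real.exp (-f x) ∂(Literature.Geometry.Lorentzian.riemannianMeasure (g.toContMDiffRiemannianMetric hg))) := by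
  intro M _ _ _ _ _ _ _ _ _ g _ f hg hc hf hsol hnorm
  rw [← PseudoRiemannianMetric.riemVolume_eq hg]
  refine ⟨fun τ hτ ↦ tracelessRicciMoment_riemVolume g f hg hc hf hsol hnorm hτ, ?_⟩
  obtain ⟨-, h1⟩ := tracelessRicciMoment_riemVolume g f hg hc hf hsol hnorm one_pos
  simp only [div_one, sub_self, zero_mul, add_zero] at h1
  linear_combination h1

/-- **Helper `helper_gradScalar_weightedIdentity_unconditional` of line `Sketch`** (the weighted
Bochner identity for `R` at every scale and at `τ = 1`, `n = 4`, UNCONDITIONAL): on every complete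
connected normalised 4-d gradient shrinking Ricci soliton, (i) for every `τ > 0`, `|∇R|² e^{-f/τ}` is
`dV`-integrable and
`∫ |∇R|² e^{-f/τ} dV = 2 ∫ R |Ric|² e^{-f/τ} dV − ∫ R² e^{-f/τ} dV − (1 − τ⁻¹) ∫ R g⁻¹(dR, df) e^{-f/τ} dV`;
(ii) at `τ = 1`: `∫ |∇R|² e^{-f} dV = 2 ∫ R |Ric|² e^{-f} dV − ∫ R² e^{-f} dV`
(`dV` the Riemannian measure of `g.toContMDiffRiemannianMetric hg`):
`gradScalar_weightedIdentity_riemVolume_unconditional`. -/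
theorem helper_gradScalar_weightedIdentity_unconditional : ∀ (M : Type) [TopologicalSpace M] [T2Space M] [SecondCountableTopology M] [ChartedSpace (EuclideanSpace ℝ (Fin 4)) M] [IsManifold (𝓡 4) ∞ M] [ConnectedSpace M] [T3Space M] [MeasurableSpace M] [BorelSpace M] (g : Literature.Geometry.Lorentzian.PseudoRiemannianMetric (𝓡 4) ∞ (EuclideanSpace ℝ (Fin 4)) (TangentSpace (𝓡 4) : M → Type _)) [g.HasLeviCivita] (f : M → ℝ) (hg : g.IsRiemannian), (∀ (x : M) (r : NNReal), IsCompact {y : M | g.edist hg x y ≤ r}) → ContMDiff (𝓡 4) 𝓘(ℝ, ℝ) ∞ f → (∀ (x : M) (X Y : TangentSpace (𝓡 4) x), g.ricci x X Y + g.hessian f x X Y = (1 / 2 : ℝ) * g.val x X Y) → (∀ x : M, g.scalarCurvature x + g.gradSq f x = f x) → (∀ τ : ℝ, 0 < τ → MeasureTheory.Integrable (fun x ↦ g.gradSq g.scalarCurvature x * Real.exp (-f x / τ)) (Literature.Geometry.Lorentzian.riemannianMeasure (g.toContMDiffRiemannianMetric hg)) ∧ ∫ x, g.gradSq g.scalarCurvature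 x * Real.exp (-f x / τ) ∂(Literature.Geometry.Lorentzian.riemannianMeasure (g.toContMDiffRiemannianMetric hg)) = 2 * (∫ x, g.scalarCurvature x * g.normSq x (g.ricci x) * Real.exp (-f x / τ) ∂(Literature.Geometry.Lorentzian.riemannianMeasure (g.toContMDiffRiemannianMetric hg))) - (∫ x, g.scalarCurvature x ^ 2 * Real.exp (-f x / τ) ∂(Literature.Geometry.Lorentzian.riemannianMeasure (g.toContMDiffRiemannianMetric hg))) - (1 - τ⁻¹) * ∫ x, g.scalarCurvature x * g.innerDual x (mvfderiv (𝓡 4) g.scalarCurvature x).toLinearMap (mvfderiv (𝓡 4) f x).toLinearMap * Real.exp (-f x / τ) ∂(Literature.Geometry.Lorentzian.riemannianMeasure (g.toContMDiffRiemannianMetric hg))) ∧ ∫ x, g.gradSq g.scalarCurvature x * Real.exp (-f x) ∂(Literature.Geometry.Lorentzian.riemannianMeasure (g.toContMDiffRiemannianMetric hg)) = 2 * (∫ x, g.scalarCurvature x * g.normSq x (g.ricci x) * Real.exp (-f x) ∂(Literature.Geometry.Lorentzian.riemannianMeasure (g.toContMDiffRiemannianMetric hg))) - (∫ x, g.scalarCurvature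 x ^ 2 * Real.exp (-f x) ∂(Literature.Geometry.Lorentzian.riemannianMeasure (g.toContMDiffRiemannianMetric hg))) := by
  intro M _ _ _ _ _ _ _ _ _ g _ f hg hc hf hsol hnorm
  rw [← PseudoRiemannianMetric.riemVolume_eq hg]
  refine ⟨fun τ hτ ↦ gradScalar_weightedIdentity_riemVolume_unconditional g f hg hc hf hsol hnorm hτ, ?_⟩
  obtain ⟨-, h1⟩ := gradScalar_weightedIdentity_riemVolume_unconditional g f hg hc hf hsol hnorm one_pos
  simp only [div_one, inv_one, sub_self, zero_mul, sub_zero] at h1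
  exact h1

end Summit.SmoothPoincare4.SmoothPoincare4.Theorems.ConicalGapSketch

end
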